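import Mathlib
import Summits.NavierStokesRegularity.NavierStokesRegularity.Theorems.EulerZoomLiouvillePowerGaugeEulerLiouvilleCondenserThinWindowGap
import Summits.NavierStokesRegularity.NavierStokesRegularity.Theorems.EulerZoomLiouvillePowerGaugeEulerLiouvilleCondenserShellSummation

/-!
# THEOREM K∞ — THE FINITE-TYPE LIOUVILLE THEOREM: K″ WITH NO THRESHOLD (nsreg-p2 g37 ROUND-47 v1.2 §5/§7 «K″'s threshold is an
artefact of (W2)», plate t50-K∞; text `r47/Sketch47.lean` v1.2 sha16 2caedb04fb0e9585, Prop `NsregP2.R47.FiniteTypeLiouville`,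
binder-for-binder)

Width piece for crux `EulerZoomLiouville.PowerGaugeEulerLiouville` (stmt-NavierStokesRegularity-19832), by name under LEAD 19832
(ns-typeII-p2 g14); seat ns-sfl-p1 g7 (K∞/K^Σ assembler), `--supports stmt-NavierStokesRegularity-19832 --as helper`.

THEOREM K″ (`Condenser.selfSimilar_ae_eq_zero_of_thinWindowSmallTypeGradientC2`, p682751) VERBATIM up to the per-window count
`hwin : ∀ ℓ ≥ R, a ℓ^{1−ρ} ≤ F(qℓ) − F(ℓ)` (`F(t) = ∫_{B(0,t)}‖DV‖²`, `a = θ2πγ²(q³−1)/(3c′q^{2+ρ}) > 0` for EVERY `c′ > 0`), now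
with the FIXED loss `θ = ½` and window ratio `q = 2` (no `exists_window_ratio`, no `thinWindow_absurd`), and then the GLOBAL
WEIGHTED budget `∫ ‖DV‖²‖y‖^{ρ−1} ≤ (1−ρ)c/(2+ρ)` (`NeedleThinCore.selfSimilar_needle_inputs`, 2nd conjunct) through ns-ezl-w2 g5's
plates (W3′) `Condenser.weightedShellBudget_of` + (W3) `Condenser.shellSummation_of` (p684285) instead of (W2): every weighted shell
increment is `≥ a·2^{ρ−1} > 0` while their partial sums are bounded — impossible for ANY `a > 0`, i.e. for ANY finite type `c′`.

* `selfSimilar_ae_eq_zero_of_finiteTypeAllRadiiC2` — implicit binders (finite type at ALL large radii);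
* `finiteTypeLiouville` — `NsregP2.R47.FiniteTypeLiouville` VERBATIM.  Supersedes K′ (p671279), K″ (p682751), K‴, K⁗ as type
  thresholds.  The LEAD's `Condenser.selfSimilar_ae_eq_zero_of_finiteTypeGradientC2` (`…CondenserInfiniteType`, p684185: finite type
  ALONG A SEQUENCE kills, via the o-form of the E-budget and THEOREM B) is the stronger liminf statement reached independently the
  same hour; this file is the thin-window/shell-summation route to the all-radii form, consuming the R47 plates by name.

HONEST FRAMING: a stratum statement about HYPOTHETICAL exactly self-similar `C²` members of crux E's class (MODEL lattice); the
ORDER `2+ρ` of the type hypothesis stays; nothing here proves the crux E (19832 OPEN), any door Target, or Navier–Stokes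
regularity. [nsreg-p2 ROUND-47 v1.2 THEOREM K∞; cite: ConstantinIgnatovaVicol2026Putative, §3.4.1; folklore (length–area method)]
-/

noncomputable section

open Set Filter Topology Metric Function MeasureTheory Real
open scoped RealInnerProductSpace NNReal ENNReal

set_option linter.dupNamespace false

namespace Summit.NavierStokesRegularity.NavierStokesRegularity.Theorems.PowerGaugeEulerLiouville.Condenser

open Literature.Analysis Literature.Analysis.FluidPDE
open Summit.NavierStokesRegularity.NavierStokesRegularity.Theorems.PowerGaugeEulerLiouville

/-! ## THEOREM K∞ -/

/-- **THEOREM K∞ — FINITE TYPE OF ORDER `2+ρ` AT ALL LARGE RADII KILLS, WITH NO THRESHOLD.**  See the module docstring.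
[nsreg-p2 ROUND-47 v1.2 THEOREM K∞; cite: ConstantinIgnatovaVicol2026Putative, §3.4.1; folklore (length–area method)] -/
theorem selfSimilar_ae_eq_zero_of_finiteTypeAllRadiiC2 {ρ : ℝ} (hρ : 0 < ρ) (hρ1 : ρ ≤ 1 / 2)
    {u : ℝ → EuclideanSpace ℝ (Fin 3) → EuclideanSpace ℝ (Fin 3)} {p : ℝ → EuclideanSpace ℝ (Fin 3) → ℝ}
    {H : ℝ → EuclideanSpace ℝ (Fin 3) → EuclideanSpace ℝ (Fin 3) →L[ℝ] EuclideanSpace ℝ (Fin 3)} {c : ℝ≥0}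
    (hc : 0 < (c : ℝ))
    (hsw : IsSuitableWeakSolutionOn (slab (EuclideanSpace ℝ (Fin 3)) (Iio 0) isOpen_Iio) 0 0 u p)
    (hH : HasWeakSpatialGradientOn (slab (EuclideanSpace ℝ (Fin 3)) (Iio 0) isOpen_Iio) u H)
    (hgauge : ∀ a : ℝ, 0 < a →
      ENNReal.ofReal (a ^ (2 * ρ)) * cknA a (0 : ℝ × EuclideanSpace ℝ (Fin 3)) u +
          ENNReal.ofReal (a ^ ρ) * cknE a (0 : ℝ × EuclideanSpace ℝ (Fin 3)) H +
        ENNReal.ofReal (a ^ (2 * ρ)) * cknD a (0 : ℝ × EuclideanSpace ℝ (Fin 3)) p ≤ (c : ℝ≥0∞))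
    {V : EuclideanSpace ℝ (Fin 3) → EuclideanSpace ℝ (Fin 3)} {P : EuclideanSpace ℝ (Fin 3) → ℝ}
    (hu : ∀ τ : ℝ, τ < 0 → u τ = selfSimilarCollapse (1 / (2 + ρ)) 0 V τ)
    (hp : ∀ τ : ℝ, τ < 0 → p τ = selfSimilarCollapsePressure (1 / (2 + ρ)) 0 P τ)
    (hV : ContDiff ℝ 2 V)
    (hgrad : ∃ c' R₀ : ℝ, ∀ R : ℝ, R₀ ≤ R →
        ∀ z ∈ ball (0 : EuclideanSpace ℝ (Fin 3)) R, ‖fderiv ℝ V z‖ ≤ Real.exp (c' * R ^ (2 + ρ))) :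
    uncurry u =ᵐ[volume.restrict (Iio (0 : ℝ) ×ˢ (univ : Set (EuclideanSpace ℝ (Fin 3))))] 0 := by
  obtain ⟨c₀, R₀, hgrad⟩ := hgrad
  have hπ : 0 < Real.pi := Real.pi_pos
  have hρ1' : ρ < 1 := by linarith
  have h2ρ : (0 : ℝ) < 2 + ρ := by linarith
  have h1ρ : (0 : ℝ) < 1 - ρ := by linarith
  have hγ : (0 : ℝ) < 1 / (2 + ρ) := one_div_pos.2 h2ρ
  have hγ2 : 1 / (2 + ρ) < 1 / 2 := one_div_lt_one_div_of_lt two_pos (by linarith)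
  have hV1 : ContDiff ℝ 1 V := hV.of_le (by norm_num)
  -- ### a classical pressure for the profile
  have hA : ∀ a : ℝ, 0 < a → ENNReal.ofReal (a ^ (2 * ρ)) *
      cknA a (0 : ℝ × EuclideanSpace ℝ (Fin 3)) u ≤ (c : ℝ≥0∞) :=
    fun a ha => le_trans (le_trans le_self_add le_self_add) (hgauge a ha)
  have hD : ∀ a : ℝ, 0 < a → ENNReal.ofReal (a ^ (2 * ρ)) *
      cknD a (0 : ℝ × EuclideanSpace ℝ (Fin 3)) p ≤ (c : ℝ≥0∞) :=
    fun a ha => le_trans le_add_self (hgauge a ha)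
  have hpm : AEStronglyMeasurable (uncurry p)
      (volume.restrict (Iio (0 : ℝ) ×ˢ (univ : Set (EuclideanSpace ℝ (Fin 3))))) := by
    have := hsw.distributional.2.2.1.aestronglyMeasurable
    simpa [slab] using this
  have hPm := aestronglyMeasurable_pressureProfile hpm hp
  have hDprof := profile_pressure_weight_of_gaugeD hρ hρ1' hpm hp hD
  have hP1 : LocallyIntegrable P volume :=
    EnergySaturation.locallyIntegrable_pressure_of_weight hρ1' hPm
      (ENNReal.mul_ne_top ENNReal.ofReal_ne_top ENNReal.coe_ne_top) hDprof
  obtain ⟨P', hprof⟩ :=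
    WeakToClassical.exists_isSelfSimilarEulerProfile_of_contDiff hsw.distributional hu hp hV hP1
  -- ### the class budgets of the profile on balls (`0 < c`)
  obtain ⟨hA', hE'⟩ :=
    NeedleThinCore.selfSimilar_needle_inputs hρ hρ1' hsw hH hgauge hu hp hV1
  obtain ⟨CA, hCA⟩ : ∃ CA : ℝ, CA = (c : ℝ) := ⟨_, rfl⟩
  have hE0 : 0 ≤ (1 - ρ) / (2 + ρ) * (c : ℝ) := by positivity
  have hCApos : 0 < CA := by rw [hCA]; exact hc
  have hbA : ∀ r : ℝ, 0 < r →
      ∫ x in ball (0 : EuclideanSpace ℝ (Fin 3)) r, ‖V x‖ ^ 2 ≤ CA * r ^ (1 - 2 * ρ) := by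
    intro r hr
    have hX : 0 ≤ CA * r ^ (1 - 2 * ρ) := by positivity
    refine setIntegral_sq_le_of_lintegral hV.continuous hX ((hA' r hr).trans ?_)
    rw [hCA, ← ENNReal.ofReal_coe_nnreal, ← ENNReal.ofReal_mul (NNReal.coe_nonneg c)]
  -- ### WLOG `c' > 0`; FIXED loss `θ = 1/2` and window ratio `q = 2` (no threshold to tune)
  obtain ⟨c', hc'def⟩ : ∃ c' : ℝ, c' = max c₀ 1 := ⟨_, rfl⟩
  have hc'pos : 0 < c' := by rw [hc'def]; exact lt_max_of_lt_right one_pos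
  have hc₀c' : c₀ ≤ c' := by rw [hc'def]; exact le_max_left _ _
  obtain ⟨θ, hθdef⟩ : ∃ θ : ℝ, θ = 1 / 2 := ⟨_, rfl⟩
  have hθ0 : 0 < θ := by rw [hθdef]; norm_num
  have hθ1 : θ < 1 := by rw [hθdef]; norm_num
  obtain ⟨q, hqdef⟩ : ∃ q : ℝ, q = 2 := ⟨_, rfl⟩
  have hq : 1 < q := by rw [hqdef]; norm_num
  have hq0 : 0 < q := by linarith
  have hQ : 0 < q ^ (2 + ρ) := Real.rpow_pos_of_pos hq0 _
  -- ### the shell condenser in gauge form at `(γ, ρ, C_A, q, θ)`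
  obtain ⟨R₁, hR₁, hBg⟩ := shellCondenserGaugeForm (1 / (2 + ρ)) ρ CA q θ hγ hρ.le hCApos hq hθ0 hθ1
  -- the window constant `a` and the Dirichlet counting function `F`
  obtain ⟨a, hadef⟩ : ∃ a : ℝ, a = θ * (2 * Real.pi * (1 / (2 + ρ)) ^ 2 * (q ^ 3 - 1)) / (3 * c' * q ^ (2 + ρ)) :=
    ⟨_, rfl⟩
  have hq3 : 0 < q ^ 3 - 1 := by nlinarith [pow_lt_pow_left₀ hq zero_le_one three_ne_zero]
  have hapos : 0 < a := by rw [hadef]; positivity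
  set F : ℝ → ℝ := fun t => ∫ z in ball (0 : EuclideanSpace ℝ (Fin 3)) t, ‖fderiv ℝ V z‖ ^ 2 with hF
  have hDVc : Continuous fun z => ‖fderiv ℝ V z‖ ^ 2 := (hV.continuous_fderiv (by norm_num)).norm.pow 2
  have hFint : ∀ t : ℝ, IntegrableOn (fun z => ‖fderiv ℝ V z‖ ^ 2) (ball (0 : EuclideanSpace ℝ (Fin 3)) t) volume :=
    fun t => (hDVc.continuousOn.integrableOn_compact (isCompact_closedBall 0 t)).mono_set ball_subset_closedBall
  have hF0 : ∀ t, 0 ≤ F t := fun t => setIntegral_nonneg measurableSet_ball fun z _ => sq_nonneg _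
  -- ### the profile is irrotational
  have hcurl : ∀ x : EuclideanSpace ℝ (Fin 3), curl V x = 0 := by
    intro x
    by_contra hxc
    -- the base radius
    obtain ⟨R, hRdef⟩ : ∃ R : ℝ, R = max (max R₁ 1) (max R₀ (‖x‖ + 1)) := ⟨_, rfl⟩
    have hRR₁ : R₁ ≤ R := by rw [hRdef]; exact (le_max_left _ _).trans (le_max_left _ _)
    have hR1 : 1 ≤ R := by rw [hRdef]; exact (le_max_right _ _).trans (le_max_left _ _)
    have hRR₀ : R₀ ≤ R := by rw [hRdef]; exact (le_max_left _ _).trans (le_max_right _ _)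
    have hRx : ‖x‖ + 1 ≤ R := by rw [hRdef]; exact (le_max_right _ _).trans (le_max_right _ _)
    have hR0 : 0 < R := by linarith
    -- every window `[ℓ, qℓ]`, `ℓ ≥ R`, pays `a ℓ^{1−ρ}`
    have hwin : ∀ ℓ : ℝ, R ≤ ℓ → a * ℓ ^ (1 - ρ) ≤ F (q * ℓ) - F ℓ := by
      intro ℓ hℓ
      have hℓ0 : 0 < ℓ := hR0.trans_le hℓ
      have hℓ1 : 1 ≤ ℓ := hR1.trans hℓ
      have hqℓ : ℓ ≤ q * ℓ := le_mul_of_one_le_left hℓ0.le hq.le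
      -- the shell budget `S_ℓ = F(qℓ) − F(ℓ)`
      have hshell : F (q * ℓ) - F ℓ =
          ∫ z in ball (0 : EuclideanSpace ℝ (Fin 3)) (q * ℓ) ∩ {x | ℓ ≤ ‖x‖}, ‖fderiv ℝ V z‖ ^ 2 := by
        rw [← ball_sdiff_ball_eq_shell, setIntegral_sdiff measurableSet_ball (hFint _) (ball_subset_ball hqℓ)]
      have hSℓ0 : 0 ≤ ∫ z in ball (0 : EuclideanSpace ℝ (Fin 3)) (q * ℓ) ∩ {x | ℓ ≤ ‖x‖}, ‖fderiv ℝ V z‖ ^ 2 :=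
        setIntegral_nonneg (measurableSet_ball.inter (measurableSet_le measurable_const continuous_norm.measurable))
          fun z _ => sq_nonneg _
      by_contra hlt
      push Not at hlt
      rw [hshell] at hlt
      -- a budget `S` strictly between `S_ℓ` and `a ℓ^{1−ρ}`
      obtain ⟨S, hSdef⟩ : ∃ S : ℝ, S =
          ((∫ z in ball (0 : EuclideanSpace ℝ (Fin 3)) (q * ℓ) ∩ {x | ℓ ≤ ‖x‖}, ‖fderiv ℝ V z‖ ^ 2) +
            a * ℓ ^ (1 - ρ)) / 2 := ⟨_, rfl⟩
      have haℓ : 0 < a * ℓ ^ (1 - ρ) := mul_pos hapos (Real.rpow_pos_of_pos hℓ0 _)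
      have hS : 0 < S := by rw [hSdef]; linarith
      have hSℓS : (∫ z in ball (0 : EuclideanSpace ℝ (Fin 3)) (q * ℓ) ∩ {x | ℓ ≤ ‖x‖}, ‖fderiv ℝ V z‖ ^ 2) ≤ S := by
        rw [hSdef]; linarith
      have hSa : S < a * ℓ ^ (1 - ρ) := by rw [hSdef]; linarith
      -- a `C²` cut-off copy agreeing with `V` on `B(0,(q+1)ℓ)`
      obtain ⟨Vc, hVc2, -, -, ⟨K, hK⟩, hVU⟩ := Loc.exists_cutoff_local hV (R := (q + 1) * ℓ) (by positivity)
      have hVc1 : ContDiff ℝ 1 Vc := hVc2.of_le (by norm_num)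
      have hsub : ball (0 : EuclideanSpace ℝ (Fin 3)) (q * ℓ) ⊆ ball (0 : EuclideanSpace ℝ (Fin 3)) ((q + 1) * ℓ) :=
        ball_subset_ball (by linarith)
      have hfd : ∀ z ∈ ball (0 : EuclideanSpace ℝ (Fin 3)) ((q + 1) * ℓ), fderiv ℝ Vc z = fderiv ℝ V z := fun z hz =>
        Filter.EventuallyEq.fderiv_eq (Filter.eventually_of_mem (isOpen_ball.mem_nhds hz) hVU)
      -- an exit from `B(0,ℓ)` through `‖·‖ = qℓ` must exist, else `curl V x = 0`
      have hex : ∃ (y : EuclideanSpace ℝ (Fin 3)) (L : ℝ), ‖y‖ < ℓ ∧ 0 ≤ L ∧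
          q * ℓ ≤ ‖ODE.evolutionMap (fun _ : ℝ => selfSimilarTransport (1 / (2 + ρ)) 0 Vc) 0 (-L) y‖ := by
        by_contra hne
        push Not at hne
        exact hxc (curl_eq_zero_of_noexit hprof hγ hγ2 hV hVc1 hK hℓ0 hq hVU
          (fun y hy L hL => hne y L hy hL) (by linarith))
      obtain ⟨y, L, hy, hL, hexit⟩ := hex
      -- budgets of the cut-off copy: amplitude on `B(0,qℓ)`, energy `≤ S` on the shell
      have hAc : ∫ z in ball (0 : EuclideanSpace ℝ (Fin 3)) (q * ℓ), ‖Vc z‖ ^ 2 ≤ CA * (q * ℓ) ^ (1 - 2 * ρ) := by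
        rw [setIntegral_congr_fun measurableSet_ball (fun z hz => by rw [hVU z (hsub hz)])]
        exact hbA _ (by positivity)
      have hEc : ∫ z in ball (0 : EuclideanSpace ℝ (Fin 3)) (q * ℓ) ∩ {x : EuclideanSpace ℝ (Fin 3) | ℓ ≤ ‖x‖},
          ‖fderiv ℝ Vc z‖ ^ 2 ≤ S := by
        rw [setIntegral_congr_fun
          (measurableSet_ball.inter (measurableSet_le measurable_const continuous_norm.measurable))
          (fun z hz => by rw [hfd z (hsub hz.1)])]
        exact hSℓS
      -- (B″_g): an exponential gradient inside `B(0,qℓ)` … under the envelope at radius `qℓ`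
      obtain ⟨z, hz, hzle⟩ := hBg Vc K hVc1 hK ℓ S (hRR₁.trans hℓ) hS hAc hEc y L hL hy hexit
      rw [hfd z (hsub hz)] at hzle
      have hqℓ0 : 0 < q * ℓ := by positivity
      have henv : ‖fderiv ℝ V z‖ ≤ Real.exp (c' * (q * ℓ) ^ (2 + ρ)) := by
        refine (hgrad (q * ℓ) (hRR₀.trans (hℓ.trans hqℓ)) z hz).trans (Real.exp_le_exp.2 ?_)
        exact mul_le_mul_of_nonneg_right hc₀c' (Real.rpow_nonneg hqℓ0.le _)
      have hineq := Real.exp_le_exp.1 (hzle.trans henv)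
      rw [Real.mul_rpow hq0.le hℓ0.le, mul_div_assoc', div_le_iff₀ (by positivity : (0 : ℝ) < 3 * S)] at hineq
      -- `a ℓ^{1−ρ} ≤ S`, contradicting `S < a ℓ^{1−ρ}`
      have hℓ3 : ℓ ^ (2 + ρ) * ℓ ^ (1 - ρ) = ℓ ^ 3 := by
        rw [← Real.rpow_add hℓ0, show (2 + ρ) + (1 - ρ) = ((3 : ℕ) : ℝ) by push_cast; ring, Real.rpow_natCast]
      have hℓQ : 0 < ℓ ^ (2 + ρ) := Real.rpow_pos_of_pos hℓ0 _
      have hfin : a * ℓ ^ (1 - ρ) ≤ S := by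
        rw [hadef, div_mul_eq_mul_div, div_le_iff₀ (by positivity)]
        refine le_of_mul_le_mul_right ?_ hℓQ
        calc θ * (2 * Real.pi * (1 / (2 + ρ)) ^ 2 * (q ^ 3 - 1)) * ℓ ^ (1 - ρ) * ℓ ^ (2 + ρ)
            = θ * (2 * Real.pi * (1 / (2 + ρ)) ^ 2 * (q ^ 3 - 1)) * (ℓ ^ (2 + ρ) * ℓ ^ (1 - ρ)) := by ring
          _ = θ * (2 * Real.pi * (1 / (2 + ρ)) ^ 2 * (q ^ 3 - 1) * ℓ ^ 3) := by rw [hℓ3]; ring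
          _ ≤ c' * (q ^ (2 + ρ) * ℓ ^ (2 + ρ)) * (3 * S) := hineq
          _ = S * (3 * c' * q ^ (2 + ρ)) * ℓ ^ (2 + ρ) := by ring
      linarith
    -- (W3′)+(W3): the GLOBAL WEIGHTED budget `∫ ‖DV‖²‖y‖^{ρ−1} ≤ C_E` cannot pay `a q^{ρ−1} > 0` per shell for ever
    have hsum : ∀ n : ℕ, ∑ k ∈ Finset.range n,
        (q ^ (k + 1) * R) ^ (ρ - 1) * (F (q ^ (k + 1) * R) - F (q ^ k * R)) ≤ (1 - ρ) / (2 + ρ) * (c : ℝ) :=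
      fun n => weightedShellBudget_of hV1 hρ1' hq hR0 hE0 hE' n
    have ha0 : a ≤ 0 := shellSummation_of hq hR0 hsum hwin
    exact absurd ha0 (not_le.2 hapos)
  -- ### conclusion
  exact Loc.selfSimilar_ae_eq_zero_of_irrotationalC2_profile hρ hsw.distributional hA hu hV hcurl

/-- **`NsregP2.R47.FiniteTypeLiouville`, binder-for-binder** (Sketch47 v1.2 of nsreg-p2 g37, sha16 2caedb04fb0e9585, plate t50-K∞;
`E3 = EuclideanSpace ℝ (Fin 3)` spelled out). [nsreg-p2 ROUND-47 v1.2 THEOREM K∞; cite: ConstantinIgnatovaVicol2026Putative, §3.4.1;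
folklore (length–area method)] -/
theorem finiteTypeLiouville :
    ∀ (ρ : ℝ), 0 < ρ → ρ ≤ 1 / 2 →
      ∀ (u : ℝ → EuclideanSpace ℝ (Fin 3) → EuclideanSpace ℝ (Fin 3)) (p : ℝ → EuclideanSpace ℝ (Fin 3) → ℝ)
        (H : ℝ → EuclideanSpace ℝ (Fin 3) → EuclideanSpace ℝ (Fin 3) →L[ℝ] EuclideanSpace ℝ (Fin 3)) (c : ℝ≥0), 0 < (c : ℝ) →
        IsSuitableWeakSolutionOn (slab (EuclideanSpace ℝ (Fin 3)) (Iio 0) isOpen_Iio) 0 0 u p →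
        HasWeakSpatialGradientOn (slab (EuclideanSpace ℝ (Fin 3)) (Iio 0) isOpen_Iio) u H →
        (∀ a : ℝ, 0 < a →
          ENNReal.ofReal (a ^ (2 * ρ)) * cknA a (0 : ℝ × EuclideanSpace ℝ (Fin 3)) u +
              ENNReal.ofReal (a ^ ρ) * cknE a (0 : ℝ × EuclideanSpace ℝ (Fin 3)) H +
            ENNReal.ofReal (a ^ (2 * ρ)) * cknD a (0 : ℝ × EuclideanSpace ℝ (Fin 3)) p ≤ (c : ℝ≥0∞)) →
        ∀ (V : EuclideanSpace ℝ (Fin 3) → EuclideanSpace ℝ (Fin 3)) (P : EuclideanSpace ℝ (Fin 3) → ℝ),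
          (∀ τ : ℝ, τ < 0 → u τ = selfSimilarCollapse (1 / (2 + ρ)) 0 V τ) →
          (∀ τ : ℝ, τ < 0 → p τ = selfSimilarCollapsePressure (1 / (2 + ρ)) 0 P τ) →
          ContDiff ℝ 2 V →
          (∃ c' R₀ : ℝ, ∀ R : ℝ, R₀ ≤ R →
              ∀ z ∈ ball (0 : EuclideanSpace ℝ (Fin 3)) R, ‖fderiv ℝ V z‖ ≤ Real.exp (c' * R ^ (2 + ρ))) →
          uncurry u =ᵐ[volume.restrict (Iio (0 : ℝ) ×ˢ (univ : Set (EuclideanSpace ℝ (Fin 3))))] 0 :=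
  fun _ hρ hρ1 _ _ _ _ hc hsw hH hgauge _ _ hu hp hV hgrad =>
    selfSimilar_ae_eq_zero_of_finiteTypeAllRadiiC2 hρ hρ1 hc hsw hH hgauge hu hp hV hgrad

end Summit.NavierStokesRegularity.NavierStokesRegularity.Theorems.PowerGaugeEulerLiouville.Condenser

end
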